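import Summits.NavierStokesRegularity.NavierStokesRegularity.Theorems.ClockStretchingLawClockCeilingStubFrameRigidity
import Summits.NavierStokesRegularity.NavierStokesRegularity.Theorems.ClockStretchingLawClockLaw
import HarnessLib

/-!
# Route `ClockStretchingLaw`, crux `ClockCeiling` (stmt-NavierStokesRegularity-10570): the CLASS-UNIFORM,
# ALL-TIME FOUR-FRAME LAW — portrait of a counterexample

Line `registered` of the crux, lead c2 (2026-08-17), `--supports` file. The four symmetry modes of an element
`u` of the route's class `𝒦_C` at time `t < 0` — the clock mode `√(-t) ∂ₜu(t,·)` and the three translation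
modes `∂ⱼu(t,·)` — are measured by the FRAME FORM
`frame_u(t; c₀, b) = √(-t) ∫ ‖(c₀√(-t)) • ∂ₜu(t,x) + ∂_b u(t,x)‖² e^{-‖x‖²/(4(-t))} dx`, `c₀² + ‖b‖² = 1`
(direction `(1,0)`: the clock amplitude `a_u(t)`). Lead c1 proved FRAME RIGIDITY per element under a clock
floor (`stub_frameRigidity`). Here the floor is made UNIFORM IN THE ELEMENT, for ALL TIMES, and free of any
clock hypothesis, on the singular elements — the only possible counterexamples to the crux (by the
certificates of this line the crux is the Type-I Liouville node):

* `uniformFrameLaw_singular_nsRescale` — zooms of a singular element are singular;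
* `uniformFrameLaw_at_neg_one` — `∀ C ∃ η(C) > 0`: every singular `u ∈ 𝒦_C` has `frame_u(-1; c₀, b) ≥ η(C)`
  on the whole unit sphere `c₀² + ‖b‖² = 1`. Proof: a degenerating sequence `(uₙ, cₙ, bₙ)` of singular
  elements; compactness of the sphere; KNSS compactness of the class on growing windows
  (`exists_tendsto_of_typeI_seq_Ioo`, ledger by `energyBounds_of_tendsto_Ioo`); the limit `W ∈ 𝒦_C` is
  SINGULAR (`uniformFrameLaw_singular_of_limit`, persistence along sequences, Albritton–Barker); the frame form
  converges continuously (`tendsto_frame_of_limit` with the modes' convergence `tendsto_timeDeriv_of_typeI`,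
  `tendsto_fderiv_apply_of_typeI` under the uniform bounds `stub_uniformBounds`), so
  `frame_W(-1; c*, b*) = 0`; the integrand vanishes identically; `c* ≠ 0`: boost Liouville
  (`stub_boostLiouville`), `c* = 0`: shear rigidity + shear Liouville (`stub_shearRigidity`,
  `stub_shearLiouville`) give `W ≡ 0` — not singular;
* `stub_uniformFrameLaw` — transported to every `t < 0` by the zoom `nsRescale √(-t)` (`frame_zoom`,
  `zoomClass_nsRescale`): **`∀ C ∃ η(C) > 0`, every singular element of `𝒦_C` satisfies
  `frame_u(t; c₀, b) ≥ η(C)` for ALL `t < 0` and ALL `c₀² + ‖b‖² = 1`.** In similarity variables: the four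
  normalised symmetry modes `{W, ∂₁U, ∂₂U, ∂₃U}` of the Leray profile of a Type-I singularity model have Gram
  matrix `≥ η(C)` in `L²(e^{-|y|²/4})` at every similarity time — the profile is never approximately
  steady, approximately shear-invariant, or approximately a travelling wave, uniformly in the model.

## References

* D. Albritton, T. Barker, J. Math. Fluid Mech. 21 (2019) = arXiv:1811.00502, Lemma 2.2, Prop. 2.3, §3.
  [AlbrittonBarker2019]
* G. Koch, N. Nadirashvili, G. Seregin, V. Šverák, Acta Math. 203 (2009) = arXiv:0709.3599, Lemma 6.1,
  Prop. 4.1, proof of Thm 6.2. [KochNadirashviliSereginSverak2009]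
-/

noncomputable section

open MeasureTheory Filter Topology Set Metric Function
open scoped NNReal ENNReal

-- `Summit = Problem` namespace duplication is the tree's layout (CONVENTIONS §1); as in every Theorems file.
set_option linter.dupNamespace false

namespace Summit.NavierStokesRegularity.NavierStokesRegularity.Theorems

open Literature.Analysis Literature.Analysis.FluidPDE
open Summit.NavierStokesRegularity.NavierStokesRegularity.Theorems.ClockLaw.Birth

/-! ### Zooms of a singular element are singular (`nsRescale` form) -/

/-- **The parabolic zoom `nsRescale c u = (t,x) ↦ c u(c²t, cx)` preserves the singularity at the origin**
(`Q(0,r)` for the zoom is `Q(0,cr)` for `u`, and `‖c u‖ = c‖u‖`). [folklore] -/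
theorem uniformFrameLaw_singular_nsRescale {u : ℝ → EuclideanSpace ℝ (Fin 3) → EuclideanSpace ℝ (Fin 3)}
    (hsing : ∀ r > 0, ∀ M : ℝ, ∃ t ∈ Set.Ioo (-(r ^ 2)) (0 : ℝ),
      ∃ x ∈ Metric.ball (0 : EuclideanSpace ℝ (Fin 3)) r, M < ‖u t x‖)
    {c : ℝ} (hc : 0 < c) :
    ∀ r > 0, ∀ M : ℝ, ∃ t ∈ Set.Ioo (-(r ^ 2)) (0 : ℝ),
      ∃ x ∈ Metric.ball (0 : EuclideanSpace ℝ (Fin 3)) r, M < ‖nsRescale c u t x‖ := by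
  intro r hr M
  have hc2 : 0 < c ^ 2 := by positivity
  obtain ⟨t, ht, x, hx, hM⟩ := hsing (c * r) (mul_pos hc hr) (M / c)
  refine ⟨t / c ^ 2, ⟨?_, div_neg_of_neg_of_pos ht.2 hc2⟩, c⁻¹ • x, ?_, ?_⟩
  · rw [lt_div_iff₀ hc2]
    have h1 : -((c * r) ^ 2) < t := ht.1
    nlinarith
  · rw [Metric.mem_ball, dist_zero_right, norm_smul, Real.norm_of_nonneg (inv_pos.2 hc).le]
    rw [Metric.mem_ball, dist_zero_right] at hx
    calc c⁻¹ * ‖x‖ < c⁻¹ * (c * r) := mul_lt_mul_of_pos_left hx (inv_pos.2 hc)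
      _ = r := by field_simp
  · have hval : nsRescale c u (t / c ^ 2) (c⁻¹ • x) = c • u t x := by
      simp only [nsRescale, smul_smul, mul_inv_cancel₀ hc.ne', one_smul, mul_div_cancel₀ _ hc2.ne']
    rw [hval, norm_smul, Real.norm_of_nonneg hc.le]
    rwa [div_lt_iff₀' hc] at hM

/-! ### Persistence of the singularity along sequences of singular class elements -/

/-- **Persistence of the singularity along sequences in the class** (sequence form of the `ClockLaw`
line's `stub_limitSingular`, which treats zooms of one element): if `w n ∈ 𝒦_C` are all unbounded in every
backward cylinder at the origin and converge pointwise on the open slab to `W`, then `W` is unbounded in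
every backward cylinder at the origin (class pressure `classPressure_holds` with its uniform
`L³ × L^{3/2}` bound, essential unboundedness `limitSingular_eLpNorm_top_eq_top`, and Albritton–Barker's
compactness + persistence `unbounded_at_origin_of_zoomIn_limit`). [cite: AlbrittonBarker2019, Lemma 2.2 and Prop. 2.3] -/
theorem uniformFrameLaw_singular_of_limit {C : ℝ}
    {w : ℕ → ℝ → EuclideanSpace ℝ (Fin 3) → EuclideanSpace ℝ (Fin 3)}
    {W : ℝ → EuclideanSpace ℝ (Fin 3) → EuclideanSpace ℝ (Fin 3)}
    (hw : ∀ n, IsTypeIAncientMild C (w n))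
    (hE : ∀ n, ∀ (x₀ : EuclideanSpace ℝ (Fin 3)) (t₀ r : ℝ), t₀ ≤ 0 → 0 < r →
      (∀ t, t₀ - r ^ 2 < t → t < t₀ → r⁻¹ * ∫ x in Metric.ball x₀ r, ‖w n t x‖ ^ 2 ≤ C) ∧
        r⁻¹ * ∫ t in Set.Ioo (t₀ - r ^ 2) t₀, ∫ x in Metric.ball x₀ r, ‖fderiv ℝ (w n t) x‖ ^ 2 ≤ C)
    (hsing : ∀ n, ∀ r > 0, ∀ M : ℝ, ∃ t ∈ Set.Ioo (-(r ^ 2)) (0 : ℝ),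
      ∃ x ∈ Metric.ball (0 : EuclideanSpace ℝ (Fin 3)) r, M < ‖w n t x‖)
    (hpt : ∀ t < 0, ∀ x, Tendsto (fun n => w n t x) atTop (𝓝 (W t x))) {r : ℝ} (hr : 0 < r)
    (M : ℝ) :
    ∃ t ∈ Set.Ioo (-(r ^ 2)) (0 : ℝ), ∃ x ∈ Metric.ball (0 : EuclideanSpace ℝ (Fin 3)) r, M < ‖W t x‖ := by
  obtain ⟨K, hK⟩ := classPressure_holds C
  have hP' : ∀ n, ∃ p : ℝ → EuclideanSpace ℝ (Fin 3) → ℝ,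
      IsSuitableWeakSolutionInBall 1 0 (w n) p ∧
        eLpNorm (Function.uncurry (w n)) 3
            (volume.restrict (parabolicCylinder 1 (0 : ℝ × EuclideanSpace ℝ (Fin 3)))) ≤ K ∧
        eLpNorm (Function.uncurry p) (3 / 2)
            (volume.restrict (parabolicCylinder 1 (0 : ℝ × EuclideanSpace ℝ (Fin 3)))) ≤ K :=
    fun n => hK _ (hw n) (hE n)
  choose P hP using hP'
  refine unbounded_at_origin_of_zoomIn_limit (W := w) (P := P) (fun n => (hP n).1) ?_
    (fun n R' hR' => ?_) ?_ r hr M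
  · refine lt_of_le_of_lt (iSup_le fun n => add_le_add (hP n).2.1 (hP n).2.2) ?_
    exact ENNReal.add_lt_top.2 ⟨ENNReal.coe_lt_top, ENNReal.coe_lt_top⟩
  · exact limitSingular_eLpNorm_top_eq_top (hw n).continuousOn_uncurry (hsing n) hR'.1
  · rintro ⟨t, x⟩ hz
    rw [SuitableCompactness.mem_parabolicCylinder_zero] at hz
    exact hpt t hz.1.2 x

/-! ### The class-uniform frame law at `t = -1` -/

/-- **Uniform four-frame floor at `t = −1` on the singular elements.** For every `C` there is `η > 0` such
that every element `u` of `𝒦_C` that is singular at the space-time origin has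
`frame_u(−1; c₀, b) ≥ η` for all `c₀² + ‖b‖² = 1`. (A degenerating sequence of singular elements has, after
extraction, a SINGULAR limit in the class whose frame vanishes in some unit direction; the vanishing
integrand makes the limit a travelling wave (`c* ≠ 0`, boost Liouville) or shear-invariant (`c* = 0`, shear
rigidity + shear Liouville), hence zero — not singular.)
[cite: AlbrittonBarker2019, Lemma 2.2 and Prop. 2.3] [cite: KochNadirashviliSereginSverak2009, Lemma 6.1, Prop. 4.1 and Thm 6.2 proof (arXiv:0709.3599)] -/
theorem uniformFrameLaw_at_neg_one (C : ℝ) :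
    ∃ η > 0, ∀ u : ℝ → EuclideanSpace ℝ (Fin 3) → EuclideanSpace ℝ (Fin 3), (ContDiffOn ℝ (⊤ : ℕ∞) (Function.uncurry u) (Set.Iio 0 ×ˢ Set.univ) ∧ (∀ t < 0, Literature.Analysis.FluidPDE.VectorCalculus.IsDivFree (u t)) ∧ (∀ s t : ℝ, s < t → t < 0 → ∀ x, u t x = Literature.Analysis.FluidPDE.heatFlow (u s) (t - s) x - ∫ τ in Set.Ioo s t, ∫ y, ((-(inner ℝ (x - y) (u τ y) / (2 * (t - τ)) * Literature.Analysis.UnboundedOperators.heatKernel (t - τ) (x - y))) • u τ y + (∫ σ in Set.Ioi (t - τ), Literature.Analysis.UnboundedOperators.heatKernel σ (x - y) / (4 * σ ^ 2)) • (inner ℝ (x - y) (u τ y) • u τ y + inner ℝ (u τ y) (u τ y) • (x - y) + inner ℝ (x - y) (u τ y) • u τ y) - ((∫ σ in Set.Ioi (t - τ), Literature.Analysis.UnboundedOperators.heatKernel σ (x - y) / (8 * σ ^ 3)) * (inner ℝ (x - y) (u τ y) * inner ℝ (x - y) (u τ y))) • (x - y))) ∧ Literature.Analysis.FluidPDE.HasTypeITimeDecay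 C u ∧ (∀ (x₀ : EuclideanSpace ℝ (Fin 3)) (t₀ r : ℝ), t₀ ≤ 0 → 0 < r → (∀ t, t₀ - r ^ 2 < t → t < t₀ → r⁻¹ * ∫ x in Metric.ball x₀ r, ‖u t x‖ ^ 2 ≤ C) ∧ r⁻¹ * ∫ t in Set.Ioo (t₀ - r ^ 2) t₀, ∫ x in Metric.ball x₀ r, ‖fderiv ℝ (u t) x‖ ^ 2 ≤ C)) →
      (∀ r > 0, ∀ M : ℝ, ∃ t ∈ Set.Ioo (-(r ^ 2)) (0 : ℝ),
        ∃ x ∈ Metric.ball (0 : EuclideanSpace ℝ (Fin 3)) r, M < ‖u t x‖) →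
      ∀ (c₀ : ℝ) (b : EuclideanSpace ℝ (Fin 3)), c₀ ^ 2 + ‖b‖ ^ 2 = 1 →
        η ≤ Real.sqrt (-(-1 : ℝ)) * ∫ x, ‖(c₀ * Real.sqrt (-(-1 : ℝ))) • timeDeriv u (-1) x +
          fderiv ℝ (u (-1)) x b‖ ^ 2 * Real.exp (-(‖x‖ ^ 2) / (4 * (-(-1 : ℝ)))) := by
  by_contra hcon
  push Not at hcon
  have hm1 : (-1 : ℝ) < 0 := by norm_num
  -- (0) a degenerating sequence `(uₙ, cₙ, bₙ)` of singular elements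
  have key : ∀ n : ℕ, ∃ (u : ℝ → EuclideanSpace ℝ (Fin 3) → EuclideanSpace ℝ (Fin 3)) (c₀ : ℝ)
      (b : EuclideanSpace ℝ (Fin 3)),
      (ContDiffOn ℝ (⊤ : ℕ∞) (Function.uncurry u) (Set.Iio 0 ×ˢ Set.univ) ∧ (∀ t < 0, Literature.Analysis.FluidPDE.VectorCalculus.IsDivFree (u t)) ∧ (∀ s t : ℝ, s < t → t < 0 → ∀ x, u t x = Literature.Analysis.FluidPDE.heatFlow (u s) (t - s) x - ∫ τ in Set.Ioo s t, ∫ y, ((-(inner ℝ (x - y) (u τ y) / (2 * (t - τ)) * Literature.Analysis.UnboundedOperators.heatKernel (t - τ) (x - y))) • u τ y + (∫ σ in Set.Ioi (t - τ), Literature.Analysis.UnboundedOperators.heatKernel σ (x - y) / (4 * σ ^ 2)) • (inner ℝ (x - y) (u τ y) • u τ y + inner ℝ (u τ y) (u τ y) • (x - y) + inner ℝ (x - y) (u τ y) • u τ y) - ((∫ σ in Set.Ioi (t - τ), Literature.Analysis.UnboundedOperators.heatKernel σ (x - y) / (8 * σ ^ 3)) * (inner ℝ (x - y) (u τ y) *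 inner ℝ (x - y) (u τ y))) • (x - y))) ∧ Literature.Analysis.FluidPDE.HasTypeITimeDecay C u ∧ (∀ (x₀ : EuclideanSpace ℝ (Fin 3)) (t₀ r : ℝ), t₀ ≤ 0 → 0 < r → (∀ t, t₀ - r ^ 2 < t → t < t₀ → r⁻¹ * ∫ x in Metric.ball x₀ r, ‖u t x‖ ^ 2 ≤ C) ∧ r⁻¹ * ∫ t in Set.Ioo (t₀ - r ^ 2) t₀, ∫ x in Metric.ball x₀ r, ‖fderiv ℝ (u t) x‖ ^ 2 ≤ C)) ∧
      (∀ r > 0, ∀ M : ℝ, ∃ t ∈ Set.Ioo (-(r ^ 2)) (0 : ℝ),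
        ∃ x ∈ Metric.ball (0 : EuclideanSpace ℝ (Fin 3)) r, M < ‖u t x‖) ∧
      c₀ ^ 2 + ‖b‖ ^ 2 = 1 ∧
      Real.sqrt (-(-1 : ℝ)) * ∫ x, ‖(c₀ * Real.sqrt (-(-1 : ℝ))) • timeDeriv u (-1) x +
        fderiv ℝ (u (-1)) x b‖ ^ 2 * Real.exp (-(‖x‖ ^ 2) / (4 * (-(-1 : ℝ)))) < 1 / ((n : ℝ) + 1) := by
    intro n
    obtain ⟨u, hu, hsing, c₀, b, hcb, hlt⟩ := hcon (1 / ((n : ℝ) + 1)) (by positivity)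
    exact ⟨u, c₀, b, hu, hsing, hcb, hlt⟩
  choose u cn bn hu hsing hcb hlt using key
  have hTI : ∀ n, IsTypeIAncientMild C (u n) := fun n =>
    isTypeIAncientMild_iff.2 ⟨(hu n).1, (hu n).2.1, (hu n).2.2.1, (hu n).2.2.2.1⟩
  have hE : ∀ n, ∀ (x₀ : EuclideanSpace ℝ (Fin 3)) (t₀ r : ℝ), t₀ ≤ 0 → 0 < r →
      (∀ t, t₀ - r ^ 2 < t → t < t₀ → r⁻¹ * ∫ x in Metric.ball x₀ r, ‖u n t x‖ ^ 2 ≤ C) ∧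
        r⁻¹ * ∫ t in Set.Ioo (t₀ - r ^ 2) t₀, ∫ x in Metric.ball x₀ r, ‖fderiv ℝ (u n t) x‖ ^ 2 ≤ C :=
    fun n => (hu n).2.2.2.2
  have hC : 0 ≤ C := (hTI 0).nonneg
  -- (i) compactness of the directions `(cₙ, bₙ)` in the closed unit ball of `ℝ × ℝ³`
  obtain ⟨p, -, ψ₀, hψ₀, hp⟩ :=
    (isCompact_closedBall (0 : ℝ × EuclideanSpace ℝ (Fin 3)) 1).tendsto_subseq
      (x := fun n => (cn n, bn n)) fun n => by
        simp only [Metric.mem_closedBall, dist_zero_right, Prod.norm_mk, max_le_iff,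
          Real.norm_eq_abs]
        exact ⟨(sq_le_one_iff_abs_le_one _).1 (by nlinarith [sq_nonneg ‖bn n‖, hcb n]),
          (pow_le_one_iff_of_nonneg (norm_nonneg _) two_ne_zero).1
            (by nlinarith [sq_nonneg (cn n), hcb n])⟩
  have hc : Tendsto (fun k => cn (ψ₀ k)) atTop (𝓝 p.1) := hp.fst_nhds
  have hb : Tendsto (fun k => bn (ψ₀ k)) atTop (𝓝 p.2) := hp.snd_nhds
  have hcbs : p.1 ^ 2 + ‖p.2‖ ^ 2 = 1 :=
    tendsto_nhds_unique ((hc.pow 2).add (hb.norm.pow 2))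
      (tendsto_const_nhds.congr fun k => (hcb (ψ₀ k)).symm)
  -- (ii) KNSS compactness of the class along `ψ₀` on the growing windows `(-(k+1), 0)`
  set w : ℕ → ℝ → EuclideanSpace ℝ (Fin 3) → EuclideanSpace ℝ (Fin 3) := fun k => u (ψ₀ k) with hw_def
  have hw : ∀ k, IsTypeIAncientMild C (w k) := fun k => hTI (ψ₀ k)
  set A : ℕ → ℝ := fun k => -((k : ℝ) + 1) with hA
  have hAt : Tendsto A atTop atBot :=
    tendsto_neg_atTop_atBot.comp (tendsto_natCast_atTop_atTop.atTop_add tendsto_const_nhds)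
  have hcont : ∀ k, ContinuousOn (uncurry (w k)) (Ioo (A k) 0 ×ˢ univ) := fun k =>
    (hw k).continuousOn_uncurry.mono (prod_mono (fun t ht => ht.2) subset_rfl)
  have hdivw : ∀ k, ∀ t ∈ Ioo (A k) 0, IsWeaklyDivFree (w k t) := fun k t ht =>
    (hw k).isWeaklyDivFree ht.2
  have hmild : ∀ k, ∀ s t : ℝ, A k < s → s < t → t < 0 → ∀ x,
      w k t x = UnboundedOperators.heatExtension (w k s) (t - s) x -
        oseenDuhamel 1 s (w k) (w k) t x :=
    fun k s t _ hst ht x => (hw k).mild_eq_heatExtension hst ht x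
  have hI : ∀ k, ∀ t ∈ Ioo (A k) 0, ∀ x, ‖w k t x‖ ≤ C / Real.sqrt (-t) := fun k t ht x =>
    (hw k).norm_le ht.2 x
  obtain ⟨φ, hφ, W, hW, hpt, hptG, -, -⟩ :=
    exists_tendsto_of_typeI_seq_Ioo C hAt hcont hdivw hmild hI
  -- the ledger passes to the limit
  have hAφ : Tendsto (fun j => A (φ j)) atTop atBot := hAt.comp hφ.tendsto_atTop
  have hLEW := energyBounds_of_tendsto_Ioo C (B := C) hC hAφ (w := fun j => w (φ j))
    (fun j => hcont (φ j)) (fun j => hdivw (φ j)) (fun j => hmild (φ j)) (fun j => hI (φ j))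
    (fun x₀ t ht r hr => Eventually.of_forall fun j =>
      scaledEnergy_le_of_ledger (hE (ψ₀ (φ j))) x₀ ht hr)
    (fun x₀ t₀ r ht₀ hr => Eventually.of_forall fun j => (hE (ψ₀ (φ j)) x₀ t₀ r ht₀.le hr).2)
    hW hpt hptG
  -- the limit is SINGULAR (persistence along the sequence of singular elements)
  have hWsing := uniformFrameLaw_singular_of_limit (fun j => hw (φ j)) (fun j => hE (ψ₀ (φ j)))
    (fun j => hsing (ψ₀ (φ j))) hpt one_pos 0
  -- the limit as an element of the inline class
  have hW' := isTypeIAncientMild_iff.1 hW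
  have hWcl : ContDiffOn ℝ (⊤ : ℕ∞) (Function.uncurry W) (Set.Iio 0 ×ˢ Set.univ) ∧ (∀ t < 0, Literature.Analysis.FluidPDE.VectorCalculus.IsDivFree (W t)) ∧ (∀ s t : ℝ, s < t → t < 0 → ∀ x, W t x = Literature.Analysis.FluidPDE.heatFlow (W s) (t - s) x - ∫ τ in Set.Ioo s t, ∫ y, ((-(inner ℝ (x - y) (W τ y) / (2 * (t - τ)) * Literature.Analysis.UnboundedOperators.heatKernel (t - τ) (x - y))) • W τ y + (∫ σ in Set.Ioi (t - τ), Literature.Analysis.UnboundedOperators.heatKernel σ (x - y) / (4 * σ ^ 2)) • (inner ℝ (x - y) (W τ y) • W τ y + inner ℝ (W τ y) (W τ y) • (x - y) + inner ℝ (x - y) (W τ y) • W τ y) - ((∫ σ in Set.Ioi (t - τ), Literature.Analysis.UnboundedOperators.heatKernel σ (x - y) / (8 * σ ^ 3)) * (inner ℝ (x - y) (W τ y) * inner ℝ (x - y) (W τ y))) • (x - y))) ∧ Literature.Analysis.FluidPDE.HasTypeITimeDecay C W ∧ (∀ (x₀ : EuclideanSpace ℝ (Fin 3)) (t₀ r :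 ℝ), t₀ ≤ 0 → 0 < r → (∀ t, t₀ - r ^ 2 < t → t < t₀ → r⁻¹ * ∫ x in Metric.ball x₀ r, ‖W t x‖ ^ 2 ≤ C) ∧ r⁻¹ * ∫ t in Set.Ioo (t₀ - r ^ 2) t₀, ∫ x in Metric.ball x₀ r, ‖fderiv ℝ (W t) x‖ ^ 2 ≤ C) :=
    ⟨hW'.1, hW'.2.1, hW'.2.2.1, hW'.2.2.2, hLEW⟩
  -- (iii) the uniform bounds and the continuous convergence of the frame form at `t = -1`
  obtain ⟨K, hK⟩ := stub_uniformBounds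
  have hbd := fun j (t : ℝ) (ht : t < 0) (x : EuclideanSpace ℝ (Fin 3)) =>
    hK C (w (φ j)) (hu (ψ₀ (φ j))) t ht x
  have htd : ∀ t < 0, ∀ x, Tendsto (fun j => timeDeriv (w (φ j)) t x) atTop (𝓝 (timeDeriv W t x)) :=
    fun t ht x => tendsto_timeDeriv_of_typeI (fun j => hw (φ j)) hW hpt
      (fun j t ht x => (hbd j t ht x).2.2.2.2) ht x
  have hfd : ∀ t < 0, ∀ x e, Tendsto (fun j => fderiv ℝ (w (φ j) t) x e) atTop
      (𝓝 (fderiv ℝ (W t) x e)) :=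
    fun t ht x e => tendsto_fderiv_apply_of_typeI (fun j => hw (φ j)) hW hpt
      (fun j t ht x => (hbd j t ht x).2.2.1) ht x e
  have h2 := tendsto_frame_of_limit (fun j => hw (φ j)) hW htd hfd (fun j t ht x => (hbd j t ht x).1)
    (fun j t ht x => (hbd j t ht x).2.1) hm1 p.1 p.2 (hc.comp hφ.tendsto_atTop)
    (hb.comp hφ.tendsto_atTop)
  -- (iv) the frame of `W` at `(-1; c*, b*)` vanishes (squeeze `0 ≤ frame < 1/(n+1)`)
  have h0 := tendsto_nhds_unique h2
    (tendsto_of_tendsto_of_tendsto_of_le_of_le tendsto_const_nhds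
      (tendsto_one_div_add_atTop_nhds_zero_nat (𝕜 := ℝ))
      (fun k => by
        beta_reduce
        exact frameRigidityOf_frame_nonneg (w (φ k)) _ _ _)
      (fun k => by
        beta_reduce
        refine (hlt (ψ₀ (φ k))).le.trans ?_
        have hk : k ≤ ψ₀ (φ k) := (hψ₀.comp hφ).le_apply
        exact one_div_le_one_div_of_le (by positivity) (by exact_mod_cast Nat.add_le_add_right hk 1)))
  -- (v) the integrand of the vanishing frame is continuous and bounded, hence identically zero
  have hVc : Continuous fun x => (p.1 * Real.sqrt (-(-1 : ℝ))) • timeDeriv W (-1) x +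
      fderiv ℝ (W (-1)) x p.2 :=
    ((frameRigidityOf_continuous_timeDeriv hWcl.1 hm1).fun_const_smul
      (p.1 * Real.sqrt (-(-1 : ℝ)))).fun_add (frameRigidityOf_continuous_fderiv_apply hWcl.1 hm1 p.2)
  have hVB : ∀ x, ‖(p.1 * Real.sqrt (-(-1 : ℝ))) • timeDeriv W (-1) x + fderiv ℝ (W (-1)) x p.2‖ ≤
      ‖p.1 * Real.sqrt (-(-1 : ℝ))‖ * (K C * (-(-1 : ℝ)) ^ (-(3 : ℝ) / 2)) +
        K C * (-(-1 : ℝ)) ^ (-(1 : ℝ)) * ‖p.2‖ := fun x => by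
    obtain ⟨hK1, hK2, -, -, -⟩ := hK C W hWcl (-1) hm1 x
    refine (norm_add_le _ _).trans (add_le_add ?_ ?_)
    · rw [norm_smul]
      exact mul_le_mul_of_nonneg_left hK1 (norm_nonneg _)
    · exact (ContinuousLinearMap.le_opNorm _ _).trans
        (mul_le_mul_of_nonneg_right hK2 (norm_nonneg _))
  have hV0 : ∀ x, (p.1 * Real.sqrt (-(-1 : ℝ))) • timeDeriv W (-1) x +
      fderiv ℝ (W (-1)) x p.2 = 0 :=
    frameRigidityOf_eq_zero_of_frame_eq_zero hVc hVB hm1 h0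
  -- (vi) Liouville: `c* ≠ 0` boost, `c* = 0` shear rigidity + shear Liouville
  have hW0 : ∀ t : ℝ, t < 0 → ∀ x, W t x = 0 := by
    by_cases hc0 : p.1 = 0
    · have hb0 : p.2 ≠ 0 := by
        intro hb0
        rw [hc0, hb0, norm_zero] at hcbs
        norm_num at hcbs
      have hV0' : ∀ x, fderiv ℝ (W (-1)) x p.2 = 0 := fun x => by
        have := hV0 x
        rwa [hc0, zero_mul, zero_smul, zero_add] at this
      exact stub_shearLiouville C W hWcl p.2 hb0 (stub_shearRigidity C W hWcl (-1) hm1 p.2 hV0')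
    · exact stub_boostLiouville C W hWcl (-1) hm1 p.1 p.2 hc0 hV0
  -- (vii) but `W` is singular at the origin
  obtain ⟨t, ht, x, -, hM⟩ := hWsing
  rw [hW0 t ht.2 x, norm_zero] at hM
  exact lt_irrefl _ hM

/-! ### The class-uniform, all-time frame law -/

/-- **Stub `stub_uniformFrameLaw` (portrait clause of crux `ClockCeiling`, line `registered`): THE
CLASS-UNIFORM, ALL-TIME FOUR-FRAME LAW.** For every `C` there is `η = η(C) > 0` such that every element `u`
of the route's Type-I model class `𝒦_C` that is singular at the space-time origin satisfies
`√(-t) ∫ ‖(c₀√(-t)) • ∂ₜu(t,x) + ∂_b u(t,x)‖² e^{-‖x‖²/(4(-t))} dx ≥ η` for EVERY `t < 0` and EVERY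
direction `c₀² + ‖b‖² = 1` (the floor at `t = -1`, `uniformFrameLaw_at_neg_one`, transported by the zoom
`nsRescale √(-t)`: the zoom is a singular element of `𝒦_C`, `zoomClass_nsRescale`,
`uniformFrameLaw_singular_nsRescale`, and `frame_{u_c}(-1; ·) = frame_u(-c²; ·)`, `frame_zoom`). The
direction `(1,0)` is the uniform clock law `stub_uniformClockLaw`; no clock floor is assumed here.
[cite: AlbrittonBarker2019, Lemma 2.2 and Prop. 2.3] [cite: KochNadirashviliSereginSverak2009, Lemma 6.1, Prop. 4.1 and Thm 6.2 proof (arXiv:0709.3599)] -/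
theorem stub_uniformFrameLaw :
    ∀ C : ℝ, ∃ η > 0, ∀ u : ℝ → EuclideanSpace ℝ (Fin 3) → EuclideanSpace ℝ (Fin 3), ContDiffOn ℝ (⊤ : ℕ∞) (Function.uncurry u) (Set.Iio 0 ×ˢ Set.univ) ∧ (∀ t < 0, Literature.Analysis.FluidPDE.VectorCalculus.IsDivFree (u t)) ∧ (∀ s t : ℝ, s < t → t < 0 → ∀ x, u t x = Literature.Analysis.FluidPDE.heatFlow (u s) (t - s) x - ∫ τ in Set.Ioo s t, ∫ y, ((-(inner ℝ (x - y) (u τ y) / (2 * (t - τ)) * Literature.Analysis.UnboundedOperators.heatKernel (t - τ) (x - y))) • u τ y + (∫ σ in Set.Ioi (t - τ), Literature.Analysis.UnboundedOperators.heatKernel σ (x - y) / (4 * σ ^ 2)) • (inner ℝ (x - y) (u τ y) • u τ y + inner ℝ (u τ y) (u τ y) • (x - y) + inner ℝ (x - y) (u τ y) • u τ y) - ((∫ σ in Set.Ioi (t - τ), Literature.Analysis.UnboundedOperators.heatKernel σ (x - y) / (8 * σ ^ 3)) * (inner ℝ (x - y) (u τ y) * inner ℝ (x - y) (u τ y)))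 • (x - y))) ∧ Literature.Analysis.FluidPDE.HasTypeITimeDecay C u ∧ (∀ (x₀ : EuclideanSpace ℝ (Fin 3)) (t₀ r : ℝ), t₀ ≤ 0 → 0 < r → (∀ t, t₀ - r ^ 2 < t → t < t₀ → r⁻¹ * ∫ x in Metric.ball x₀ r, ‖u t x‖ ^ 2 ≤ C) ∧ r⁻¹ * ∫ t in Set.Ioo (t₀ - r ^ 2) t₀, ∫ x in Metric.ball x₀ r, ‖fderiv ℝ (u t) x‖ ^ 2 ≤ C) → (∀ r > 0, ∀ M : ℝ, ∃ t ∈ Set.Ioo (-(r ^ 2)) (0 : ℝ), ∃ x ∈ Metric.ball (0 : EuclideanSpace ℝ (Fin 3)) r, M < ‖u t x‖) → ∀ t : ℝ, t < 0 → ∀ (c₀ : ℝ) (b : EuclideanSpace ℝ (Fin 3)), c₀ ^ 2 + ‖b‖ ^ 2 = 1 → η ≤ Real.sqrt (-t) * ∫ x, ‖(c₀ * Real.sqrt (-t)) • Literature.Analysis.FluidPDE.timeDeriv u t x + fderiv ℝ (u t) x b‖ ^ 2 * Real.exp (-(‖x‖ ^ 2) / (4 * (-t))) := by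
  intro C
  obtain ⟨η, hη, hη1⟩ := uniformFrameLaw_at_neg_one C
  refine ⟨η, hη, fun u hu hsing t ht c₀ b hcb => ?_⟩
  have hTI : IsTypeIAncientMild C u :=
    isTypeIAncientMild_iff.2 ⟨hu.1, hu.2.1, hu.2.2.1, hu.2.2.2.1⟩
  -- the zoom with `c = √(-t)` is a singular element of the class
  set c : ℝ := Real.sqrt (-t) with hc
  have hcpos : 0 < c := Real.sqrt_pos.2 (neg_pos.2 ht)
  have hcsq : c ^ 2 = -t := Real.sq_sqrt (neg_nonneg.2 ht.le)
  have hc2t : c ^ 2 * (-1 : ℝ) = t := by rw [hcsq]; ring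
  have key := hη1 (nsRescale c u) (zoomClass_nsRescale C c u hcpos hu)
    (uniformFrameLaw_singular_nsRescale hsing hcpos) c₀ b hcb
  -- covariance of the frame form under the zoom
  have hneg : c ^ 2 * (-1 : ℝ) < 0 := by rw [hc2t]; exact ht
  rw [frame_zoom hcpos
    (fun y => ((steadySlice_hasDerivAt_curve hTI.contDiffOn y hneg).1).differentiableAt)
    ((hTI.contDiff_slice hneg).differentiable (by simp)) c₀ b, hc2t] at key
  exact key

end Summit.NavierStokesRegularity.NavierStokesRegularity.Theorems

end
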